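import Summits.CriticalPhenomena.SAWScalingLimit.Theorems.SAWDevelopingMapObservableToSLETypeLadderCarvedReductionSqueezeGateFacts
import Summits.CriticalPhenomena.SAWScalingLimit.Theorems.SAWDevelopingMapObservableToSLETypeLadderCarvedReductionSqueezeGateHalfBall
import Summits.CriticalPhenomena.SAWScalingLimit.Theorems.SAWDefectDecoherenceObservableToSLERNestedLinkDefs
import HarnessLib

/-!
# Gate and body data of the pinned frame, for both gates at once (piece (T-A′ E2) of stub T-A′
# `stub_carvedReduction_squeezeGeometry_domains`)

Crux `SAWDevelopingMap.ObservableToSLE` (stmt-CriticalPhenomena-10472), line `six-class-type-ladder`,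
stub T-A′ `stub_carvedReduction_squeezeGeometry_domains`.  Landing target:
`Summits/CriticalPhenomena/SAWScalingLimit/Theorems/SAWDevelopingMapObservableToSLETypeLadderCarvedReductionSqueezeSupGateData.lean`
(`--supports stmt-CriticalPhenomena-10472`; registered carrier `stub_carvedReduction_supGateData`).

Worker log §E, steps E2 (+ the lattice inputs of E7): from the hypotheses of the super-domain
assembly (`…SqueezeSuperSup`, same binder block) — the pinned gates lie within `R` of the pinned
roots (`dist_gate_root_le`, `dist_limit_gate_root_le`), which are `> 2 (R + ρ)` apart; the
pinned gates in the form `s_j c_q - s_j · triEmbed x_j` converge to `Pᵢ` strictly from above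
(`pinnedGate_eq`); present vertices of the windows lie strictly above the gate lines
(`gate_present_above`); the limit bodies stay `ρ/4` off the open upper half-balls
(`gate_le_dist_of_persistent`), are connected, contain `Pᵢ - (ρ/2) i` and the pinned roots, and
lie in `closedBall αᵢ R` (`stub_carvedReduction_gateBounds`); bookkeeping on the approximants;
`q'_j ∉ S (n)` eventually; the gate centres lie in `closure D`.  Everything `Fin 2`-indexed by
`![P₀, P₁]`, `![D.pt 0 - τ, D.pt 1 - τ]`, `![BS, BT]`, `![BpS, BpT]`.
-/

noncomputable section

open scoped Topology ComplexConjugate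
open Filter Set Metric Bornology
open Literature.Probability.LatticeModels (HexVertex hexGraph hexCenter triZeta triEmbed Site)
open Literature.Probability.RandomPlanarGeometry
open Literature.Probability.RandomPlanarGeometry.SAW
open Literature.Topology.PlaneTopology

namespace Summit.CriticalPhenomena.SAWScalingLimit.Theorems.ObservableToSLE.TypeLadder

open Summit.CriticalPhenomena.SAWScalingLimit.Theorems.ObservableToSLER.BridgeGate (HasCleanWindow)
open Summit.CriticalPhenomena.SAWScalingLimit.Theorems.ObservableToSLER.NestedGate

/-- **Registered carrier `stub_carvedReduction_supGateData`** (crux item stmt-CriticalPhenomena-10472,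
stub T-A′ `stub_carvedReduction_squeezeGeometry_domains`, piece GATE AND BODY DATA — short carrier):
points converging to two limits `> 2R` apart are eventually `> 2R + s_j` apart (`s_j → 0`); used
for `q'_j ∉ S (n)`. -/
theorem stub_carvedReduction_supGateData :
    ∀ (u v : ℕ → ℂ) (A B : ℂ) (s : ℕ → ℝ) (R : ℝ), Tendsto s atTop (𝓝 0) → Tendsto u atTop (𝓝 A) → Tendsto v atTop (𝓝 B) →
      2 * R < dist A B → ∀ᶠ j in atTop, 2 * R + s j < dist (u j) (v j) := by
  intro u v A B s R hs hu hv hR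
  have hlim : Tendsto (fun j => dist (u j) (v j) - s j) atTop (𝓝 (dist A B - 0)) := (hu.dist hv).sub hs
  rw [sub_zero] at hlim
  filter_upwards [hlim.eventually (lt_mem_nhds hR)] with j hj
  linarith

/-- **Gate and body data of the pinned frame** (worker log E2); see the module docstring.  Same
binder block as `stub_carvedReduction_superSup`. -/
theorem supGateData :
    ∀ (D : DobrushinDomain) (a b : ℝ → HexVertex), IsEmbEndpointApprox hexGraph hexCenter D a b →
    ∀ (δ : ℕ → ℝ) (ρ R : ℝ) (N : ℕ) (S T : ℕ → ℕ → Set HexVertex) (n n' : ℕ → ℕ) (q q' : ℕ → HexVertex)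
      (κ : ℕ → ℕ) (x : ℕ → Site 2) (τ P₀ P₁ : ℂ) (H : ℂ ≃ₜ ℂ) (d : Fin 2 → ℂ) (β ε : ℝ)
      (BS BT : Set ℂ) (BpS BpT : ℕ → Set ℂ),
      0 < ρ → ρ ≤ R → R + ρ ≤ ε → 2 * (R + ρ) < dist (D.pt 0) (D.pt 1) →
      (∀ j, 0 < δ (κ j)) → Tendsto (fun j => δ (κ j)) atTop (𝓝 0) →
      Tendsto (fun j => ((δ (κ j) : ℝ) : ℂ) * triEmbed (x j)) atTop (𝓝 τ) →
      (∀ j, TameNestedFamily (δ (κ j)) R N (a (δ (κ j))) (S (κ j)) ∧ TameNestedFamily (δ (κ j)) R N (b (δ (κ j))) (T (κ j))) →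
      (∀ k, ∃ (γ : HexDomainSAW D.carrier (δ k) (a (δ k)) (b (δ k))) (m : ℕ) (p : HexVertex) (m' : ℕ) (p' : HexVertex),
        IsFirstGoodGateN D.carrier (δ k) ρ R (S k) (a (δ k)) γ.walk.support (n k) m p (q k) ∧
        IsFirstGoodGateN D.carrier (δ k) ρ R (T k) (b (δ k)) γ.walk.support.reverse (n' k) m' p' (q' k) ∧
        WideLink D.carrier (δ k) ρ (S k (n k) ∪ T k (n' k)) (q k) (q' k)) →
      (∀ k, (q k).2 = 0) → (∀ k, (q' k).2 = 0) →
      Tendsto (fun j => ((δ (κ j) : ℝ) : ℂ) * hexCenter (((q (κ j)).1 - x j, 0) : HexVertex)) atTop (𝓝 P₀) →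
      Tendsto (fun j => ((δ (κ j) : ℝ) : ℂ) * hexCenter (((q' (κ j)).1 - x j, 0) : HexVertex)) atTop (𝓝 P₁) →
      (∀ j, P₀.im < (((δ (κ j) : ℝ) : ℂ) * hexCenter (((q (κ j)).1 - x j, 0) : HexVertex)).im) →
      (∀ j, P₁.im < (((δ (κ j) : ℝ) : ℂ) * hexCenter (((q' (κ j)).1 - x j, 0) : HexVertex)).im) →
      (∀ᶠ j in atTop, ∀ v : HexVertex,
        ((δ (κ j) : ℝ) : ℂ) * hexCenter v - ((δ (κ j) : ℝ) : ℂ) * triEmbed (x j) ∈ ball P₀ (ρ / 2) →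
          (v ∈ S (κ j) (n (κ j)) ∪ T (κ j) (n' (κ j)) ↔ v.1 1 < (q (κ j)).1 1)) →
      (∀ᶠ j in atTop, ∀ v : HexVertex,
        ((δ (κ j) : ℝ) : ℂ) * hexCenter v - ((δ (κ j) : ℝ) : ℂ) * triEmbed (x j) ∈ ball P₁ (ρ / 2) →
          (v ∈ S (κ j) (n (κ j)) ∪ T (κ j) (n' (κ j)) ↔ v.1 1 < (q' (κ j)).1 1)) →
      (∀ᶠ j in atTop, closedBall (P₀ + ((δ (κ j) : ℝ) : ℂ) * triEmbed (x j)) (ρ / 2) ⊆ D.carrier ∧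
        closedBall (P₁ + ((δ (κ j) : ℝ) : ℂ) * triEmbed (x j)) (ρ / 2) ⊆ D.carrier) →
      (∀ j, q (κ j) ∈ embMeshDomain hexGraph hexCenter D.carrier (δ (κ j))) →
      -- the D-level envelope data
      (∀ i, H (d i) = D.pt i) →
      (∀ (τ' : ℂ) (i k : Fin 2), i ≠ k →
        Disjoint ((H.trans (Homeomorph.addRight (-τ'))) ''
            {w : ℂ | 1 ≤ (w * conj (d k)).re ∧ (1 - β) * ‖w‖ ≤ (w * conj (d k)).re})
          (ball (H (d i) - τ') ε)) →
      (∀ (τ' : ℂ) (ϱ₀ ζ : ℝ), 0 < ζ →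
        ∃ (r₁ r₂ : ℝ) (J : JordanDomain) (η : Fin 2 → Set ℂ) (xx : Fin 2 → Fin 2 → ℂ) (F : Fin 2 → Set ℂ),
          1 < r₁ ∧ r₁ < r₂ ∧
          J.carrier = (H.trans (Homeomorph.addRight (-τ'))) '' ball 0 r₂ ∧
          frontier J.carrier = (H.trans (Homeomorph.addRight (-τ'))) '' sphere 0 r₂ ∧
          closure ((fun z => z - τ') '' D.carrier) = (H.trans (Homeomorph.addRight (-τ'))) '' closedBall 0 1 ∧
          closure ((fun z => z - τ') '' D.carrier) ⊆ J.carrier ∧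
          (∀ i, closedBall (D.pt i - τ') ϱ₀ ⊆ J.carrier) ∧
          (∀ i, J.IsCrosscut (η i) (xx i 0) (xx i 1)) ∧ (∀ i, η i \ {xx i 0, xx i 1} ⊆ F i) ∧
          (∀ i, IsOpen (F i)) ∧ (∀ i, IsConnected (F i)) ∧ (∀ i, F i ⊆ J.carrier) ∧
          (∀ i, Disjoint (closure (F i)) ((H.trans (Homeomorph.addRight (-τ'))) '' closedBall 0 1)) ∧
          (∀ i, F i ⊆ (H.trans (Homeomorph.addRight (-τ'))) ''
            {w : ℂ | 1 ≤ (w * conj (d i)).re ∧ (1 - β) * ‖w‖ < (w * conj (d i)).re}) ∧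
          Disjoint (F 0 ∪ {xx 0 0, xx 0 1}) (F 1 ∪ {xx 1 0, xx 1 1}) ∧
          (∀ i, ∃ z ∈ F i, dist z (D.pt i - τ') < ζ) ∧
          (∀ i k, xx i k ∈ frontier J.carrier)) →
      -- the limit bodies of the package
      (IsCompact BS ∧ IsConnected BS ∧ D.pt 0 - τ ∈ BS ∧ P₀ - ((ρ / 2 : ℝ) : ℂ) * Complex.I ∈ BS) →
      (IsCompact BT ∧ IsConnected BT ∧ D.pt 1 - τ ∈ BT ∧ P₁ - ((ρ / 2 : ℝ) : ℂ) * Complex.I ∈ BT) →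
      (∀ j, IsCompact (BpS j) ∧ IsConnected (BpS j) ∧ ∀ v : HexVertex,
        infDist (((δ (κ j) : ℝ) : ℂ) * hexCenter v - ((δ (κ j) : ℝ) : ℂ) * triEmbed (x j)) (BpS j) ≤ ρ / 4 →
          v ∈ S (κ j) (n (κ j))) →
      (∀ j, IsCompact (BpT j) ∧ IsConnected (BpT j) ∧ ∀ v : HexVertex,
        infDist (((δ (κ j) : ℝ) : ℂ) * hexCenter v - ((δ (κ j) : ℝ) : ℂ) * triEmbed (x j)) (BpT j) ≤ ρ / 4 →
          v ∈ T (κ j) (n' (κ j))) →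
      Tendsto (fun j => hausdorffDist (BpS j) BS) atTop (𝓝 0) → Tendsto (fun j => hausdorffDist (BpT j) BT) atTop (𝓝 0) →
      (∀ ε₁ > (0 : ℝ), ∀ᶠ j in atTop, ∀ v : HexVertex,
        (infDist (((δ (κ j) : ℝ) : ℂ) * hexCenter v - ((δ (κ j) : ℝ) : ℂ) * triEmbed (x j)) BS ≤ ρ / 4 - ε₁ →
          v ∈ S (κ j) (n (κ j))) ∧
        (infDist (((δ (κ j) : ℝ) : ℂ) * hexCenter v - ((δ (κ j) : ℝ) : ℂ) * triEmbed (x j)) BT ≤ ρ / 4 - ε₁ →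
          v ∈ T (κ j) (n' (κ j)))) →
      (∀ i, dist (![P₀, P₁] i) (![D.pt 0 - τ, D.pt 1 - τ] i) ≤ R) ∧
      2 * (R + ρ) < dist (![D.pt 0 - τ, D.pt 1 - τ] (0 : Fin 2)) (![D.pt 0 - τ, D.pt 1 - τ] (1 : Fin 2)) ∧
      Tendsto (fun j => ((δ (κ j) : ℝ) : ℂ) * hexCenter (q (κ j)) - ((δ (κ j) : ℝ) : ℂ) * triEmbed (x j)) atTop (𝓝 P₀) ∧
      Tendsto (fun j => ((δ (κ j) : ℝ) : ℂ) * hexCenter (q' (κ j)) - ((δ (κ j) : ℝ) : ℂ) * triEmbed (x j)) atTop (𝓝 P₁) ∧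
      (∀ j, P₀.im < (((δ (κ j) : ℝ) : ℂ) * hexCenter (q (κ j)) - ((δ (κ j) : ℝ) : ℂ) * triEmbed (x j)).im) ∧
      (∀ j, P₁.im < (((δ (κ j) : ℝ) : ℂ) * hexCenter (q' (κ j)) - ((δ (κ j) : ℝ) : ℂ) * triEmbed (x j)).im) ∧
      (∀ i, ∀ᶠ j in atTop, ∀ v : HexVertex, ((δ (κ j) : ℝ) : ℂ) * hexCenter v - ((δ (κ j) : ℝ) : ℂ) * triEmbed (x j) ∈ ball (![P₀, P₁] i) (ρ / 2) →
        v ∉ S (κ j) (n (κ j)) ∪ T (κ j) (n' (κ j)) → (![P₀, P₁] i).im < (((δ (κ j) : ℝ) : ℂ) * hexCenter v - ((δ (κ j) : ℝ) : ℂ) * triEmbed (x j)).im) ∧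
      (∀ i, ∀ bb ∈ ![BS, BT] i, ∀ z : ℂ, dist z (![P₀, P₁] i) < ρ / 2 → (![P₀, P₁] i).im < z.im → ρ / 4 ≤ dist bb z) ∧
      (∀ i, IsConnected (![BS, BT] i)) ∧ (∀ i, ![P₀, P₁] i - ((ρ / 2 : ℝ) : ℂ) * Complex.I ∈ ![BS, BT] i) ∧
      (∀ i, ![D.pt 0 - τ, D.pt 1 - τ] i ∈ ![BS, BT] i) ∧ (∀ i, ![BS, BT] i ⊆ closedBall (![D.pt 0 - τ, D.pt 1 - τ] i) R) ∧
      (∀ i, (![BS, BT] i).Nonempty) ∧ (∀ i, IsBounded (![BS, BT] i)) ∧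
      (∀ i j, (![BpS, BpT] i j).Nonempty) ∧ (∀ i j, IsBounded (![BpS, BpT] i j)) ∧
      (∀ i j (v : HexVertex), infDist (((δ (κ j) : ℝ) : ℂ) * hexCenter v - ((δ (κ j) : ℝ) : ℂ) * triEmbed (x j)) (![BpS, BpT] i j) ≤ ρ / 4 →
        v ∈ S (κ j) (n (κ j)) ∪ T (κ j) (n' (κ j))) ∧
      (∀ i, Tendsto (fun j => hausdorffDist (![BpS, BpT] i j) (![BS, BT] i)) atTop (𝓝 0)) ∧
      (∀ᶠ j in atTop, q' (κ j) ∉ S (κ j) (n (κ j))) ∧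
      (∀ᶠ j in atTop, closedBall (P₀ + ((δ (κ j) : ℝ) : ℂ) * triEmbed (x j)) (ρ / 2) ⊆ D.carrier ∧
        closedBall (P₁ + ((δ (κ j) : ℝ) : ℂ) * triEmbed (x j)) (ρ / 2) ⊆ D.carrier) ∧
      (∀ j, ((δ (κ j) : ℝ) : ℂ) * hexCenter (q (κ j)) ∈ closure D.carrier) := by
  intro D a b hab δ ρ R N S T n n' q q' κ x τ P₀ P₁ H d β ε BS BT BpS BpT hρ hρR hRε hsep hs hs0 hτ hfam hgates hq2 hq2'
    hconv₀ hconv₁ habove₀ habove₁ hU₀ hU₁ hballs hqdom hHd hcone hexits hBS hBT hBpS hBpT hHS hHT hper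
  -- Step 0: notation
  set U : ℕ → Set HexVertex := fun j => S (κ j) (n (κ j)) ∪ T (κ j) (n' (κ j)) with hUdef
  set α : Fin 2 → ℂ := ![D.pt 0 - τ, D.pt 1 - τ] with hαdef
  set P : Fin 2 → ℂ := ![P₀, P₁] with hPdef
  set B : Fin 2 → Set ℂ := ![BS, BT] with hBdef
  set Bp : Fin 2 → ℕ → Set ℂ := ![BpS, BpT] with hBpdef
  have hP0 : P 0 = P₀ := rfl
  have hP1 : P 1 = P₁ := rfl
  have hα0 : α 0 = D.pt 0 - τ := rfl
  have hα1 : α 1 = D.pt 1 - τ := rfl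
  have hB0 : B 0 = BS := rfl
  have hB1 : B 1 = BT := rfl
  have hs0' : Tendsto (fun j => δ (κ j)) atTop (𝓝[>] 0) :=
    tendsto_nhdsWithin_iff.2 ⟨hs0, Eventually.of_forall fun j => hs j⟩
  -- the pinned gates in the form `s c_q - s · triEmbed x`
  have hgate₀ : ∀ j, ((δ (κ j) : ℝ) : ℂ) * hexCenter (((q (κ j)).1 - x j, 0) : HexVertex) =
      ((δ (κ j) : ℝ) : ℂ) * hexCenter (q (κ j)) - ((δ (κ j) : ℝ) : ℂ) * triEmbed (x j) := fun j => pinnedGate_eq (δ (κ j)) (x j) (hq2 (κ j))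
  have hgate₁ : ∀ j, ((δ (κ j) : ℝ) : ℂ) * hexCenter (((q' (κ j)).1 - x j, 0) : HexVertex) =
      ((δ (κ j) : ℝ) : ℂ) * hexCenter (q' (κ j)) - ((δ (κ j) : ℝ) : ℂ) * triEmbed (x j) := fun j => pinnedGate_eq (δ (κ j)) (x j) (hq2' (κ j))
  have hconv₀' : Tendsto (fun j => ((δ (κ j) : ℝ) : ℂ) * hexCenter (q (κ j)) - ((δ (κ j) : ℝ) : ℂ) * triEmbed (x j)) atTop (𝓝 P₀) := by
    refine hconv₀.congr fun j => hgate₀ j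
  have hconv₁' : Tendsto (fun j => ((δ (κ j) : ℝ) : ℂ) * hexCenter (q' (κ j)) - ((δ (κ j) : ℝ) : ℂ) * triEmbed (x j)) atTop (𝓝 P₁) := by
    refine hconv₁.congr fun j => hgate₁ j
  have habove₀' : ∀ j, P₀.im < (((δ (κ j) : ℝ) : ℂ) * hexCenter (q (κ j)) - ((δ (κ j) : ℝ) : ℂ) * triEmbed (x j)).im := fun j => by
    rw [← hgate₀ j]; exact habove₀ j
  have habove₁' : ∀ j, P₁.im < (((δ (κ j) : ℝ) : ℂ) * hexCenter (q' (κ j)) - ((δ (κ j) : ℝ) : ℂ) * triEmbed (x j)).im := fun j => by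
    rw [← hgate₁ j]; exact habove₁ j
  -- Step 1: what the realised gates give at each level
  have hgf : ∀ j, closedBall (((δ (κ j) : ℝ) : ℂ) * hexCenter (q (κ j))) ρ ⊆ D.carrier ∧
      dist (((δ (κ j) : ℝ) : ℂ) * hexCenter (q (κ j))) (((δ (κ j) : ℝ) : ℂ) * hexCenter (a (δ (κ j)))) ≤ R + δ (κ j) ∧
      dist (((δ (κ j) : ℝ) : ℂ) * hexCenter (q' (κ j))) (((δ (κ j) : ℝ) : ℂ) * hexCenter (b (δ (κ j)))) ≤ R + δ (κ j) := by
    intro j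
    obtain ⟨γ, m, p, m', p', hgS, hgT, -⟩ := hgates (κ j)
    obtain ⟨-, -, hclean, -, -⟩ := firstGoodGateN_facts γ.walk hgS
    have hgT' : IsFirstGoodGateN D.carrier (δ (κ j)) ρ R (T (κ j)) (b (δ (κ j))) γ.walk.reverse.support (n' (κ j)) m' p' (q' (κ j)) := by
      rwa [SimpleGraph.Walk.support_reverse]
    exact ⟨hclean, dist_gate_root_le (hs j).le γ.walk hgS (hfam j).1, dist_gate_root_le (hs j).le γ.walk.reverse hgT' (hfam j).2⟩
  -- roots converge
  have hroot₀ : Tendsto (fun j => ((δ (κ j) : ℝ) : ℂ) * hexCenter (a (δ (κ j)))) atTop (𝓝 (D.pt 0)) := hab.tendsto_fst.comp hs0'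
  have hroot₁ : Tendsto (fun j => ((δ (κ j) : ℝ) : ℂ) * hexCenter (b (δ (κ j)))) atTop (𝓝 (D.pt 1)) := hab.tendsto_snd.comp hs0'
  have hproot₀ : Tendsto (fun j => ((δ (κ j) : ℝ) : ℂ) * hexCenter (a (δ (κ j))) - ((δ (κ j) : ℝ) : ℂ) * triEmbed (x j)) atTop (𝓝 (D.pt 0 - τ)) :=
    hroot₀.sub hτ
  have hproot₁ : Tendsto (fun j => ((δ (κ j) : ℝ) : ℂ) * hexCenter (b (δ (κ j))) - ((δ (κ j) : ℝ) : ℂ) * triEmbed (x j)) atTop (𝓝 (D.pt 1 - τ)) :=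
    hroot₁.sub hτ
  -- the pinned gates are within `R` of the pinned roots
  have hPα : ∀ i, dist (P i) (α i) ≤ R := by
    have h0 : dist P₀ (D.pt 0 - τ) ≤ R := dist_limit_gate_root_le hs0 hconv₀' hproot₀ fun j => by
      rw [dist_pinned_eq]; exact (hgf j).2.1
    have h1 : dist P₁ (D.pt 1 - τ) ≤ R := dist_limit_gate_root_le hs0 hconv₁' hproot₁ fun j => by
      rw [dist_pinned_eq]; exact (hgf j).2.2
    intro i; fin_cases i
    · exact h0
    · exact h1
  have hαsep : 2 * (R + ρ) < dist (α 0) (α 1) := by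
    rw [hα0, hα1, dist_pinned_eq]; exact hsep
  -- Step 2: the windows: present vertices strictly above, bodies far from the upper half-balls
  have hU : ∀ i, ∀ᶠ j in atTop, ∀ v : HexVertex, ((δ (κ j) : ℝ) : ℂ) * hexCenter v - ((δ (κ j) : ℝ) : ℂ) * triEmbed (x j) ∈ ball (P i) (ρ / 2) →
      (v ∈ U j ↔ v.1 1 < ((![q, q'] i) (κ j)).1 1) := by
    intro i; fin_cases i
    · exact hU₀
    · exact hU₁
  have hconvP : ∀ i, Tendsto (fun j => ((δ (κ j) : ℝ) : ℂ) * hexCenter ((((![q, q'] i) (κ j)).1 - x j, 0) : HexVertex)) atTop (𝓝 (P i)) := by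
    intro i; fin_cases i
    · exact hconv₀
    · exact hconv₁
  have haboveP : ∀ i j, (P i).im < (((δ (κ j) : ℝ) : ℂ) * hexCenter ((((![q, q'] i) (κ j)).1 - x j, 0) : HexVertex)).im := by
    intro i; fin_cases i
    · exact habove₀
    · exact habove₁
  have hup : ∀ i, ∀ᶠ j in atTop, ∀ v : HexVertex, ((δ (κ j) : ℝ) : ℂ) * hexCenter v - ((δ (κ j) : ℝ) : ℂ) * triEmbed (x j) ∈ ball (P i) (ρ / 2) →
      v ∉ U j → (P i).im < (((δ (κ j) : ℝ) : ℂ) * hexCenter v - ((δ (κ j) : ℝ) : ℂ) * triEmbed (x j)).im := by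
    intro i
    filter_upwards [gate_present_above (q := fun j => (![q, q'] i) (κ j)) hs (hU i)] with j hj v hv hvU
    exact (haboveP i j).trans_le (hj v hv hvU)
  have hperB : ∀ i, ∀ ε₁ > (0 : ℝ), ∀ᶠ j in atTop, ∀ v : HexVertex,
      infDist (((δ (κ j) : ℝ) : ℂ) * hexCenter v - ((δ (κ j) : ℝ) : ℂ) * triEmbed (x j)) (B i) ≤ ρ / 4 - ε₁ → v ∈ U j := by
    intro i ε₁ hε₁
    filter_upwards [hper ε₁ hε₁] with j hj v hv
    fin_cases i
    · exact Or.inl ((hj v).1 hv)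
    · exact Or.inr ((hj v).2 hv)
  have hBfar : ∀ i, ∀ bb ∈ B i, ∀ z : ℂ, dist z (P i) < ρ / 2 → (P i).im < z.im → ρ / 4 ≤ dist bb z :=
    fun i bb hbb z hz hzim => gate_le_dist_of_persistent hs hs0 (hconvP i) (hU i) (hperB i) hbb hz hzim
  -- Step 3: the bodies: connected, containing `P i - (ρ/2) i` and the pinned root, inside `closedBall (α i) R`
  have hBc : ∀ i, IsConnected (B i) := by
    intro i; fin_cases i
    · exact hBS.2.1
    · exact hBT.2.1
  have hgB : ∀ i, P i - ((ρ / 2 : ℝ) : ℂ) * Complex.I ∈ B i := by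
    intro i; fin_cases i
    · exact hBS.2.2.2
    · exact hBT.2.2.2
  have hαB : ∀ i, α i ∈ B i := by
    intro i; fin_cases i
    · exact hBS.2.2.1
    · exact hBT.2.2.1
  have hBα : ∀ i, B i ⊆ closedBall (α i) R := by
    have h0 : BS ⊆ closedBall (D.pt 0 - τ) R :=
      stub_carvedReduction_gateBounds (fun j => δ (κ j)) x (fun j => S (κ j) (n (κ j))) (fun j => a (δ (κ j))) BpS BS (D.pt 0 - τ) R (ρ / 4) hs hs0
        (by positivity) (fun j v hv => (hBpS j).2.2 v hv) (fun j v hv => (hfam j).1.2.2.1 (n (κ j)) v hv) hproot₀ hHS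
        (fun j => (hBpS j).2.1.nonempty) (fun j => (hBpS j).1.isBounded) hBS.2.1.nonempty hBS.1.isBounded
    have h1 : BT ⊆ closedBall (D.pt 1 - τ) R :=
      stub_carvedReduction_gateBounds (fun j => δ (κ j)) x (fun j => T (κ j) (n' (κ j))) (fun j => b (δ (κ j))) BpT BT (D.pt 1 - τ) R (ρ / 4) hs hs0
        (by positivity) (fun j v hv => (hBpT j).2.2 v hv) (fun j v hv => (hfam j).2.2.2.1 (n' (κ j)) v hv) hproot₁ hHT
        (fun j => (hBpT j).2.1.nonempty) (fun j => (hBpT j).1.isBounded) hBT.2.1.nonempty hBT.1.isBounded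
    intro i; fin_cases i
    · exact h0
    · exact h1
  have hBpne : ∀ i j, (Bp i j).Nonempty := by
    intro i j; fin_cases i
    · exact (hBpS j).2.1.nonempty
    · exact (hBpT j).2.1.nonempty
  have hBpb : ∀ i j, IsBounded (Bp i j) := by
    intro i j; fin_cases i
    · exact (hBpS j).1.isBounded
    · exact (hBpT j).1.isBounded
  have hBne : ∀ i, (B i).Nonempty := fun i => ⟨_, hαB i⟩
  have hBb : ∀ i, IsBounded (B i) := by
    intro i; fin_cases i
    · exact hBS.1.isBounded
    · exact hBT.1.isBounded
  have hBpU : ∀ i j (v : HexVertex), infDist (((δ (κ j) : ℝ) : ℂ) * hexCenter v - ((δ (κ j) : ℝ) : ℂ) * triEmbed (x j)) (Bp i j) ≤ ρ / 4 → v ∈ U j := by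
    intro i j v hv; fin_cases i
    · exact Or.inl ((hBpS j).2.2 v hv)
    · exact Or.inr ((hBpT j).2.2 v hv)
  have hHB : ∀ i, Tendsto (fun j => hausdorffDist (Bp i j) (B i)) atTop (𝓝 0) := by
    intro i; fin_cases i
    · exact hHS
    · exact hHT
  have hq'S : ∀ᶠ j in atTop, q' (κ j) ∉ S (κ j) (n (κ j)) := by
    have h1 : ∀ᶠ j in atTop, 2 * R + δ (κ j) < dist (((δ (κ j) : ℝ) : ℂ) * hexCenter (a (δ (κ j)))) (((δ (κ j) : ℝ) : ℂ) * hexCenter (b (δ (κ j)))) :=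
      stub_carvedReduction_supGateData _ _ _ _ (fun j => δ (κ j)) R hs0 hroot₀ hroot₁ (by linarith)
    filter_upwards [h1] with j hj hmem
    have hqa : dist (((δ (κ j) : ℝ) : ℂ) * hexCenter (q' (κ j))) (((δ (κ j) : ℝ) : ℂ) * hexCenter (a (δ (κ j)))) ≤ R :=
      (hfam j).1.2.2.1 (n (κ j)) _ hmem
    have hqb := (hgf j).2.2
    linarith [dist_triangle (((δ (κ j) : ℝ) : ℂ) * hexCenter (a (δ (κ j)))) (((δ (κ j) : ℝ) : ℂ) * hexCenter (q' (κ j))) (((δ (κ j) : ℝ) : ℂ) * hexCenter (b (δ (κ j)))),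
      dist_comm (((δ (κ j) : ℝ) : ℂ) * hexCenter (a (δ (κ j)))) (((δ (κ j) : ℝ) : ℂ) * hexCenter (q' (κ j)))]
  have hqΩ : ∀ j, ((δ (κ j) : ℝ) : ℂ) * hexCenter (q (κ j)) ∈ closure D.carrier := fun j =>
    subset_closure ((embMeshDomain_subset hexGraph hexCenter D.carrier (δ (κ j))) (hqdom j))
  exact ⟨hPα, hαsep, hconv₀', hconv₁', habove₀', habove₁', hup, hBfar, hBc, hgB, hαB, hBα, hBne, hBb, hBpne, hBpb, hBpU, hHB, hq'S,
    hballs, hqΩ⟩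

end Summit.CriticalPhenomena.SAWScalingLimit.Theorems.ObservableToSLE.TypeLadder

end
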